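import Literature.Algebra.Homology.OrderedCechSystemCup
import HarnessLib

/-!
# The Leibniz rule for the cup product on the ordered Čech complex of systems of modules
# (Godement, *Topologie algébrique et théorie des faisceaux*, II §6.6; Görtz–Wedhorn II (21.29); Stacks 01FP)

Sequel to `Algebra/Homology/OrderedCechSystemCup` (the cup product `cup β p q n : Čᵖ(M) × Čᵠ(N) → Čⁿ(P)` along a
natural pairing `β` of systems of `A`-modules on the finite subsets of a linearly ordered index set, in the vertex-free
form `(f ∪ g)_σ = Σ_{v ∈ σ} β_σ (f.ext0At σ_{≤v} σ) (g.ext0At σ_{≥v} σ)`).  THEOREMS ONLY: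

* **`sysD_cup` (Leibniz rule):** for a natural pairing, `p, q ≥ 0` and `p + q = n`,
  `d (f ∪ g) = (d f) ∪ g + (-1)^p • f ∪ (d g)` in `Čⁿ⁺¹(P)` ([Godement1958, II §6.6, Thm. 6.6.1 (the coboundary of a
  cup product)]; [GortzWedhorn2023, (21.29)]).  Proof: `d(f ∪ g)_τ` is a double sum over pairs `a ≠ v` of vertices of
  `τ` (`a` the erased vertex, `v` the cut); the pairs `a < v` give `(d f) ∪ g`, the pairs `a > v` give
  `(-1)^p f ∪ (d g)` (sign bookkeeping `sign_lowerCut_of_le` / `sign_eq_pow_mul_sign_upperCut` of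
  `Algebra/Homology/OrderedCechCuts`), and the two «diagonal» families `a = v` of the right-hand side cancel after
  reindexing by predecessor/successor (`sum_diag_cancel`);
* `sysD_cup_eq_zero`, `cup_sysD_left`, `cup_sysD_right` — cocycles cup to cocycles, and the cup of a cocycle with a
  coboundary is a coboundary: the cup product descends to cohomology;
* `sysCochainMap_cup` — naturality in the systems (morphisms intertwining the pairings intertwine the cups).

Everything here is proved; no definitions, no named facts.  Library only (cell hodgecm-mathlib, FLOOR-0 P1 F-11 road
A, jobs J3/J4-(iv)); HC_CM is proved only modulo the 7 printed citations until rung 0 closes, and nothing here bears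
on it.

## References

* [Godement1958] R. Godement, *Topologie algébrique et théorie des faisceaux*, Hermann (1958), II §6.6.
* [GortzWedhorn2023] U. Görtz, T. Wedhorn, *Algebraic Geometry II: Cohomology of Schemes* (2023), Def. 21.68, (21.29).
* [StacksProject] The Stacks Project, Tag 01FP (cup product on Čech cohomology).
-/

universe v u

open CategoryTheory

set_option backward.isDefEq.respectTransparency false

noncomputable section

namespace Literature.Algebra.Homology

namespace OrderedCech

variable {ι : Type} [LinearOrder ι]

/-! ### The Leibniz rule -/

section Leibniz

variable {A : Type u} [CommRing A] {M N P : Finset ι ⥤ ModuleCat.{v} A}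
  {β : ∀ s : Finset ι, M.obj s →ₗ[A] N.obj s →ₗ[A] P.obj s}

/-- The «diagonal» terms of the Leibniz rule cancel: summing over the vertices `v` of `s`,
`Σ_v (-1)^{#{b<v}} β(f.ext0At {b<v} t, g.ext0At s_{≥v} t) = -(-1)^p Σ_v β(f.ext0At s_{≤v} t, g.ext0At {b>v} t)`
for a `p`-cochain `f` (reindex `v ↦ (Finset.filter (· < only) v`;).max' cuts with `#s_{≤w} = p + 1` contribute). [folklore] [cite: Godement1958, II §6.6] -/
theorem sum_diag_cancel {p q : ℤ} (hp : 0 ≤ p) (f : SysCochain M p) (g : SysCochain N q) (s t : Finset ι) :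
    ∑ v ∈ s, ((-1 : A) ^ (s.filter (· < v)).card) • β t (f.ext0At (s.filter (· < v)) t) (g.ext0At (Finset.filter (v ≤ ·) s) t)
      = -(((-1 : A) ^ p.toNat) • ∑ w ∈ s, β t (f.ext0At (Finset.filter (· ≤ w) s) t) (g.ext0At (s.filter (w < ·)) t)) := by
  -- the two index sets: vertices with a predecessor / with a successor
  set S₁ : Finset ι := s.filter (fun v => (s.filter (· < v)).Nonempty) with hS₁
  set S₂ : Finset ι := s.filter (fun w => (s.filter (w < ·)).Nonempty) with hS₂
  -- the summands
  set F₁ : ι → P.obj t := fun v =>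
    ((-1 : A) ^ (s.filter (· < v)).card) • β t (f.ext0At (s.filter (· < v)) t) (g.ext0At (Finset.filter (v ≤ ·) s) t) with hF₁
  set F₂ : ι → P.obj t := fun w => β t (f.ext0At (Finset.filter (· ≤ w) s) t) (g.ext0At (s.filter (w < ·)) t) with hF₂
  -- `ext0At` at the empty set vanishes
  have hf0 : f.ext0At (∅ : Finset ι) t = 0 := by
    unfold SysCochain.ext0At
    rw [dif_neg]
    rintro ⟨⟨h, _⟩, _⟩
    exact Finset.not_nonempty_empty h
  have hg0 : g.ext0At (∅ : Finset ι) t = 0 := by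
    unfold SysCochain.ext0At
    rw [dif_neg]
    rintro ⟨⟨h, _⟩, _⟩
    exact Finset.not_nonempty_empty h
  -- restrict both sums to the index sets
  have h1 : ∑ v ∈ s, F₁ v = ∑ v ∈ S₁, F₁ v := by
    rw [hS₁, Finset.sum_filter]
    refine Finset.sum_congr rfl fun v _ => ?_
    split_ifs with h
    · rfl
    · rw [hF₁]
      simp only
      rw [Finset.not_nonempty_iff_eq_empty.1 h, hf0, map_zero, LinearMap.zero_apply, smul_zero]
  have h2 : ∑ w ∈ s, F₂ w = ∑ w ∈ S₂, F₂ w := by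
    rw [hS₂, Finset.sum_filter]
    refine Finset.sum_congr rfl fun w _ => ?_
    split_ifs with h
    · rfl
    · rw [hF₂]
      simp only
      rw [Finset.not_nonempty_iff_eq_empty.1 h, hg0, map_zero]
  change ∑ v ∈ s, F₁ v = -(((-1 : A) ^ p.toNat) • ∑ w ∈ s, F₂ w)
  rw [h1, h2, Finset.smul_sum, ← Finset.sum_neg_distrib]
  -- the bijection `v ↦ (Finset.filter (· < `w) v`,).max' ↦ succ w`
  refine Finset.sum_nbij' (fun v => if h : (s.filter (· < v)).Nonempty then (Finset.filter (· < v) s).max' h else v)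
    (fun w => if h : (s.filter (w < ·)).Nonempty then (Finset.filter (w < ·) s).min' h else w) ?_ ?_ ?_ ?_ ?_
  · -- `pred` maps `S₁` into `S₂`
    intro v hv
    rw [hS₁, Finset.mem_filter] at hv
    rw [dif_pos hv.2, hS₂, Finset.mem_filter]
    exact ⟨(pred_mem_lt s v hv.2).1, ⟨v, Finset.mem_filter.2 ⟨hv.1, (pred_mem_lt s v hv.2).2⟩⟩⟩
  · -- `succ` maps `S₂` into `S₁`
    intro w hw
    rw [hS₂, Finset.mem_filter] at hw
    rw [dif_pos hw.2, hS₁, Finset.mem_filter]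
    exact ⟨(succ_mem_lt s w hw.2).1, ⟨w, Finset.mem_filter.2 ⟨hw.1, (succ_mem_lt s w hw.2).2⟩⟩⟩
  · -- left inverse
    intro v hv
    rw [hS₁, Finset.mem_filter] at hv
    have h' : (s.filter ((Finset.filter (· < v) s).max' hv.2 < ·)).Nonempty := ⟨v, Finset.mem_filter.2 ⟨hv.1, (pred_mem_lt s v hv.2).2⟩⟩
    simp only [dif_pos hv.2, dif_pos h']
    exact succ_pred s hv.1 hv.2 h'
  · -- right inverse
    intro w hw
    rw [hS₂, Finset.mem_filter] at hw
    have h' : (s.filter (· < (Finset.filter (w < ·) s).min' hw.2)).Nonempty := ⟨w, Finset.mem_filter.2 ⟨hw.1, (succ_mem_lt s w hw.2).2⟩⟩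
    simp only [dif_pos hw.2, dif_pos h']
    exact pred_succ s hw.1 hw.2 h'
  · -- the summands agree
    intro v hv
    rw [hS₁, Finset.mem_filter] at hv
    rw [dif_pos hv.2, hF₁, hF₂]
    simp only
    have e1 := filter_lt_eq_lowerCut_pred s v hv.2
    have e2 := upperCut_eq_filter_lt_pred s hv.2
    set w := (Finset.filter (· < v) s).max' hv.2 with hw
    clear_value w
    rw [e1, e2]
    by_cases hc : ((Finset.filter (· ≤ w) s).card : ℤ) = p + 1
    · have hcard : (Finset.filter (· ≤ w) s).card = p.toNat + 1 := by omega
      rw [hcard, pow_succ, mul_neg_one, neg_smul]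
    · rw [ext0At_lowerCut_eq_zero f s t w hc, map_zero, LinearMap.zero_apply, smul_zero, smul_zero, neg_zero]

/-- **Leibniz rule for the ordered Čech cup product.**  For a natural pairing `β`, `p, q ≥ 0` with `p + q = n`,
a `p`-cochain `f` of `M` and a `q`-cochain `g` of `N`:
`d (f ∪ g) = (d f) ∪ g + (-1)^p • f ∪ (d g)` in `Čⁿ⁺¹(P)`.
[cite: Godement1958, II §6.6] [cite: GortzWedhorn2023, (21.29)] -/
theorem sysD_cup (hβ : IsNaturalPairing β) {p q n : ℤ} (hp : 0 ≤ p) (hq : 0 ≤ q) (hpq : p + q = n)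
    (f : SysCochain M p) (g : SysCochain N q) :
    sysD P n (cup β p q n f g) =
      cup β (p + 1) q (n + 1) (sysD M p f) g + ((-1 : A) ^ p.toNat) • cup β p (q + 1) (n + 1) f (sysD N q g) := by
  funext τ
  -- the simplex `S = τ`, `#S = n + 2`
  set S : Finset ι := τ.1 with hS
  have hScard : (S.card : ℤ) = n + 1 + 1 := τ.2.2
  -- the common summand of the left-hand side
  set T : ι → ι → P.obj S := fun a v =>
    sign A S a • β S (f.ext0At ((Finset.filter (· ≤ v) S).erase a) S) (g.ext0At ((Finset.filter (v ≤ ·) S).erase a) S) with hT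
  -- (1) the left-hand side as a double sum over pairs `a ≠ v`
  have hL : sysD P n (cup β p q n f g) τ = ∑ v ∈ S, ∑ a ∈ S.erase v, T a v := by
    rw [sysD_apply]
    have h1 : ∀ a ∈ S, sign A S a • (cup β p q n f g).ext0At (S.erase a) S = ∑ v ∈ S.erase a, T a v := by
      intro a ha
      have hne : (S.erase a).Nonempty ∧ ((S.erase a).card : ℤ) = n + 1 := by
        have hc := Finset.card_erase_of_mem ha
        refine ⟨Finset.card_pos.1 (by omega), by omega⟩
      rw [ext0At_cup hβ f g (S.erase a) S hne (Finset.erase_subset a S), Finset.smul_sum]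
      refine Finset.sum_congr rfl fun v _ => ?_
      rw [hT]
      simp only
      rw [lowerCut_erase, upperCut_erase]
    rw [Finset.sum_congr rfl h1]
    exact Finset.sum_comm' fun a v => by
      simp only [Finset.mem_erase]
      constructor
      · rintro ⟨ha, hva, hv⟩
        exact ⟨⟨Ne.symm hva, ha⟩, hv⟩
      · rintro ⟨⟨hav, ha⟩, hv⟩
        exact ⟨ha, Ne.symm hav, hv⟩
  -- (2) splitting `S ∖ v` into the parts below and above `v`
  have hsplit : ∀ v : ι, S.erase v = S.filter (· < v) ∪ S.filter (v < ·) := by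
    intro v
    ext b
    simp only [Finset.mem_erase, Finset.mem_union, Finset.mem_filter]
    constructor
    · rintro ⟨hbv, hb⟩
      rcases lt_or_gt_of_ne hbv with h | h
      · exact Or.inl ⟨hb, h⟩
      · exact Or.inr ⟨hb, h⟩
    · rintro (⟨hb, h⟩ | ⟨hb, h⟩)
      · exact ⟨ne_of_lt h, hb⟩
      · exact ⟨ne_of_gt h, hb⟩
  have hdisj : ∀ v : ι, Disjoint (S.filter (· < v)) (S.filter (v < ·)) := by
    intro v
    rw [Finset.disjoint_left]
    intro b hb hb'
    exact lt_asymm (Finset.mem_filter.1 hb).2 (Finset.mem_filter.1 hb').2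
  have hlow_erase : ∀ v : ι, (Finset.filter (· ≤ v) S).erase v = S.filter (· < v) := by
    intro v
    ext b
    simp only [Finset.mem_erase, Finset.mem_filter]
    constructor
    · rintro ⟨hbv, hb, hle⟩
      exact ⟨hb, lt_of_le_of_ne hle hbv⟩
    · rintro ⟨hb, hlt⟩
      exact ⟨ne_of_lt hlt, hb, le_of_lt hlt⟩
  have hup_erase : ∀ v : ι, (Finset.filter (v ≤ ·) S).erase v = S.filter (v < ·) := by
    intro v
    ext b
    simp only [Finset.mem_erase, Finset.mem_filter]
    constructor
    · rintro ⟨hbv, hb, hle⟩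
      exact ⟨hb, lt_of_le_of_ne hle (Ne.symm hbv)⟩
    · rintro ⟨hb, hlt⟩
      exact ⟨ne_of_gt hlt, hb, le_of_lt hlt⟩
  -- (3) the summands below / above `v`
  have hTlow : ∀ v : ι, ∀ a ∈ S.filter (· < v),
      T a v = sign A (Finset.filter (· ≤ v) S) a •
        β S (f.ext0At ((Finset.filter (· ≤ v) S).erase a) S) (g.ext0At (Finset.filter (v ≤ ·) S) S) := by
    intro v a ha
    have hav : a < v := (Finset.mem_filter.1 ha).2
    rw [hT]
    simp only
    rw [upperCut_erase_of_lt S hav, sign_lowerCut_of_le S (le_of_lt hav)]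
  have hTup : ∀ v ∈ S, ∀ a ∈ S.filter (v < ·),
      T a v = ((-1 : A) ^ p.toNat) • (sign A (Finset.filter (v ≤ ·) S) a •
        β S (f.ext0At (Finset.filter (· ≤ v) S) S) (g.ext0At ((Finset.filter (v ≤ ·) S).erase a) S)) := by
    intro v hvS a ha
    have hva : v < a := (Finset.mem_filter.1 ha).2
    rw [hT]
    simp only
    rw [lowerCut_erase_of_lt S hva, sign_eq_pow_mul_sign_upperCut S (le_of_lt hva), smul_smul]
    by_cases hc : ((Finset.filter (· ≤ v) S).card : ℤ) = p + 1
    · -- `#{b < v} = p`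
      have hv : v ∈ Finset.filter (· ≤ v) S := mem_lowerCut.2 ⟨hvS, le_rfl⟩
      have hcard : (S.filter (· < v)).card = p.toNat := by
        rw [← hlow_erase v, Finset.card_erase_of_mem hv]
        omega
      rw [hcard]
    · rw [ext0At_lowerCut_eq_zero f S S v hc, map_zero, LinearMap.zero_apply, smul_zero, smul_zero]
  -- (4) the first term of the right-hand side
  have hR1 : cup β (p + 1) q (n + 1) (sysD M p f) g τ =
      ∑ v ∈ S, (∑ a ∈ S.filter (· < v), T a v +
        ((-1 : A) ^ (S.filter (· < v)).card) • β S (f.ext0At (S.filter (· < v)) S) (g.ext0At (Finset.filter (v ≤ ·) S) S)) := by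
    rw [cup_apply]
    refine Finset.sum_congr rfl fun v hv => ?_
    rw [ext0At_sysD_of_nonneg p hp f (Finset.filter (· ≤ v) S) S (lowerCut_subset S v), map_sum, LinearMap.sum_apply,
      ← Finset.sum_erase_add _ _ (self_mem_lowerCut hv), hlow_erase v]
    congr 1
    · refine Finset.sum_congr rfl fun a ha => ?_
      rw [map_smul, LinearMap.smul_apply, hTlow v a ha]
    · rw [map_smul, LinearMap.smul_apply, sign_lowerCut_self, ← hlow_erase v]
  -- (5) the second term of the right-hand side
  have hR2 : ((-1 : A) ^ p.toNat) • cup β p (q + 1) (n + 1) f (sysD N q g) τ =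
      ∑ v ∈ S, (∑ a ∈ S.filter (v < ·), T a v +
        ((-1 : A) ^ p.toNat) • β S (f.ext0At (Finset.filter (· ≤ v) S) S) (g.ext0At (S.filter (v < ·)) S)) := by
    rw [cup_apply, Finset.smul_sum]
    refine Finset.sum_congr rfl fun v hv => ?_
    rw [ext0At_sysD_of_nonneg q hq g (Finset.filter (v ≤ ·) S) S (upperCut_subset S v), map_sum,
      ← Finset.sum_erase_add _ _ (self_mem_upperCut hv), hup_erase v, smul_add, Finset.smul_sum]
    congr 1
    · refine Finset.sum_congr rfl fun a ha => ?_
      rw [map_smul, hTup v hv a ha]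
    · rw [map_smul, sign_upperCut_self, one_smul, ← hup_erase v]
  -- (6) assemble
  change sysD P n (cup β p q n f g) τ =
    cup β (p + 1) q (n + 1) (sysD M p f) g τ + ((-1 : A) ^ p.toNat) • cup β p (q + 1) (n + 1) f (sysD N q g) τ
  rw [hL, hR1, hR2, Finset.sum_add_distrib, Finset.sum_add_distrib, sum_diag_cancel hp f g S S,
    ← Finset.smul_sum]
  have hTsplit : ∑ v ∈ S, ∑ a ∈ S.erase v, T a v =
      ∑ v ∈ S, ∑ a ∈ S.filter (· < v), T a v + ∑ v ∈ S, ∑ a ∈ S.filter (v < ·), T a v := by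
    rw [← Finset.sum_add_distrib]
    refine Finset.sum_congr rfl fun v _ => ?_
    rw [hsplit v, Finset.sum_union (hdisj v)]
  rw [hTsplit]
  abel

/-- Cocycles cup to cocycles. [cite: Godement1958, II §6.6] -/
theorem sysD_cup_eq_zero (hβ : IsNaturalPairing β) {p q n : ℤ} (hp : 0 ≤ p) (hq : 0 ≤ q) (hpq : p + q = n)
    {f : SysCochain M p} {g : SysCochain N q} (hf : sysD M p f = 0) (hg : sysD N q g = 0) :
    sysD P n (cup β p q n f g) = 0 := by
  rw [sysD_cup hβ hp hq hpq, hf, hg, map_zero, map_zero, LinearMap.zero_apply, smul_zero, add_zero]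

/-- The cup of a coboundary with a cocycle is a coboundary: `(d e) ∪ g = d (e ∪ g)` for `d g = 0`.
[cite: Godement1958, II §6.6] -/
theorem cup_sysD_left (hβ : IsNaturalPairing β) {p q n : ℤ} (hp : 0 ≤ p) (hq : 0 ≤ q) (hpq : p + q = n)
    (e : SysCochain M p) {g : SysCochain N q} (hg : sysD N q g = 0) :
    cup β (p + 1) q (n + 1) (sysD M p e) g = sysD P n (cup β p q n e g) := by
  rw [sysD_cup hβ hp hq hpq, hg, map_zero, smul_zero, add_zero]

/-- The cup of a cocycle with a coboundary is a coboundary: `f ∪ (d e) = (-1)^p d (f ∪ e)` for `d f = 0`.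
[cite: Godement1958, II §6.6] -/
theorem cup_sysD_right (hβ : IsNaturalPairing β) {p q n : ℤ} (hp : 0 ≤ p) (hq : 0 ≤ q) (hpq : p + q = n)
    {f : SysCochain M p} (hf : sysD M p f = 0) (e : SysCochain N q) :
    cup β p (q + 1) (n + 1) f (sysD N q e) = ((-1 : A) ^ p.toNat) • sysD P n (cup β p q n f e) := by
  have h := sysD_cup hβ hp hq hpq f e
  rw [hf, map_zero, LinearMap.zero_apply, zero_add] at h
  rw [h, smul_smul, ← pow_add, ← two_mul, pow_mul, neg_one_sq, one_pow, one_smul]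

end Leibniz


/-! ### Functoriality in the systems -/

section Map

variable {A : Type u} [CommRing A] {M N P M' N' P' : Finset ι ⥤ ModuleCat.{v} A}
  {β : ∀ s : Finset ι, M.obj s →ₗ[A] N.obj s →ₗ[A] P.obj s}
  {β' : ∀ s : Finset ι, M'.obj s →ₗ[A] N'.obj s →ₗ[A] P'.obj s}
  (φ : M ⟶ M') (ψ : N ⟶ N') (χ : P ⟶ P')

/-- **The cup product is natural in the systems**: morphisms of systems `φ, ψ, χ` intertwining the pairings
(`χ (β (x, y)) = β' (φ x, ψ y)`) intertwine the cup products on cochains. [cite: Godement1958, II §6.6] -/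
theorem sysCochainMap_cup (hφ : ∀ (s : Finset ι) (x : M.obj s) (y : N.obj s),
      (χ.app s).hom (β s x y) = β' s ((φ.app s).hom x) ((ψ.app s).hom y))
    {p q n : ℤ} (f : SysCochain M p) (g : SysCochain N q) :
    sysCochainMap χ n (cup β p q n f g) = cup β' p q n (sysCochainMap φ p f) (sysCochainMap ψ q g) := by
  funext σ
  rw [sysCochainMap_apply, cup_apply, cup_apply, map_sum]
  refine Finset.sum_congr rfl fun v _ => ?_
  rw [hφ, ext0At_sysCochainMap, ext0At_sysCochainMap]

end Map

end OrderedCech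

end Literature.Algebra.Homology

end
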